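import Mathlib
import HarnessLib
import Summits.Langlands.Langlands.Theses.TriangulineChamber
import Literature.NumberTheory.GaloisRepresentations.LocalKroneckerWeberInertiaProofs

/-!
# `LiftB2CrysSplitP` (item stmt-Langlands-8575) — the cyclotomic-powers pin, localised

The first conjunct of every `∃ RD`-slice of route `TriangulineChamber` (`LiftB2CrysGeneric`,
`LiftB2CrysUnramifiedP`, `LiftB2CrysRamifiedP`, `LiftB2CrysSplitP`) is the PIN

  `∀ (m : ℤ) (χ : Γ_F →ₜ* GL₁(ℚ̄_p)), χ = ε^m ⇒ ∀ v ∣ p, ∀ τ, HT_τ(χ|_{Γ_{F_v}}) = {-m}`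

relative to the datum `RD.pst p v hv`.  Since the human ruling D-0018 L2 (2026-08-16) that datum
is `Literature.NumberTheory.PAdicHodge.fontainePstAdicCompletion v p hv` — Fontaine's datum pinned
by SPECIFICATION (`Classical.epsilon` over the clauses `IsFontaineDatum` (F1)–(F7)) — and does not
depend on `RD`.  None of the clauses (F1)–(F7) mentions the labelled Hodge–Tate weights of the
powers of the cyclotomic character ((F2) `CyclotomicWeightNegOne` is the UNLABELLED interval
condition `IsDeRhamWithWeightsIn (-1) (-1)` on a finite `ℚ_p`-model of `ε` itself), so the PIN is
at present not derivable in the tree, even from `FontaineDatumExists`.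

This file isolates exactly what is missing, as a helper for the item (`--supports`):

* `pin_of_localPin` — the PIN conjunct (for every `RD`) follows from its LOCAL form for the
  pinned datum at each `v ∣ p`: "every rank-one framed representation of `Γ_{F_v}` whose entry is
  `ε_{F_v}^m` has `τ`-labelled Hodge–Tate weights `{-m}` for `fontainePstAdicCompletion v p hv`"
  — the candidate clause (F8) of `IsFontaineDatum` (a theorem of the literature for the genuine
  `B_dR(F_v)`: `D_dR(ℚ_p(m)) = F_v · t^{-m}`, Fontaine 1994, Exp. III §1.5).  The bridge is the
  compatibility of the cyclotomic character with restriction to a decomposition group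
  (accepted `cyclotomicCharacter_absGaloisRestrict`).

No statement of the route file is altered; no definition is introduced (the local form is a
hypothesis written inline).  Axioms: `propext`, `Classical.choice`, `Quot.sound`.
-/

-- project-wide option (lakefile weak.linter.dupNamespace); `Summit.Langlands.Langlands` is mandated
set_option linter.dupNamespace false

namespace Summit.Langlands.Langlands.Theorems.LiftB2CrysSplitP

open Summit.Langlands.Langlands.Theses.TriangulineChamber
open NumberField IsDedekindDomain
open Literature.NumberTheory.GaloisRepresentations

/-- **The cyclotomic-powers pin, from its local form.**  Let `F` be a number field and `p` a
prime.  Suppose that at every place `v ∣ p`, for the pinned `p`-adic Hodge datum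
`D = fontainePstAdicCompletion v p hv` (with its `ℚ_p`-structure `D.algebra` on `F_v`), every
rank-one framed representation `χᵥ : Γ_{F_v} →ₜ* GL₁(ℚ̄_p)` whose entry is `ε_{F_v}(σ)^m` has
`τ`-labelled Hodge–Tate weights `{-m}` for every `ℚ_p`-embedding `τ : F_v → ℚ̄_p` (the local
clause; Fontaine 1994, Exp. III §1.5 for the genuine `B_dR(F_v)`).  Then for EVERY reciprocity
datum `RD` the first conjunct of `LiftB2CrysSplitP` holds: every global rank-one `χ` with entry
`ε_F(σ)^m` has labelled weights `{-m}` at every `v ∣ p` relative to `RD.pst p v hv` — because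
`RD.pst p v hv` IS the pinned datum (definitionally) and `ε_F ∘ res = ε_{F_v}`
(`cyclotomicCharacter_absGaloisRestrict`). [folklore] -/
theorem pin_of_localPin (F : Type) [Field F] [NumberField F] (p : ℕ) [Fact p.Prime]
    (hloc : ∀ (v : HeightOneSpectrum (𝓞 F)) (hv : ((p : ℕ) : 𝓞 F) ∈ v.asIdeal) (m : ℤ)
      (χv : FramedGaloisRep (v.adicCompletion F) (PadicAlgCl p) 1),
      (∀ σ, (χv σ).val 0 0 = algebraMap ℚ_[p] (PadicAlgCl p)
        ((((GaloisRep.cyclotomicCharacter (v.adicCompletion F) p σ : ℤ_[p]ˣ) : ℤ_[p]) :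
          ℚ_[p]) ^ m)) →
      let D := Literature.NumberTheory.PAdicHodge.fontainePstAdicCompletion v p hv
      letI := D.algebra
      ∀ τ : v.adicCompletion F →ₐ[ℚ_[p]] PadicAlgCl p,
        D.𝔅.labelledHodgeTateWeights χv.toGaloisRep τ.toRingHom = {-m})
    (RD : ReciprocityData F) :
    ∀ (m : ℤ) (χ : FramedGaloisRep F (PadicAlgCl p) 1),
      (∀ σ, (χ σ).val 0 0 = algebraMap ℚ_[p] (PadicAlgCl p)
        ((((GaloisRep.cyclotomicCharacter F p σ : ℤ_[p]ˣ) : ℤ_[p]) : ℚ_[p]) ^ m)) →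
      ∀ (v : HeightOneSpectrum (𝓞 F)) (hv : ((p : ℕ) : 𝓞 F) ∈ v.asIdeal),
        let D := RD.pst p v hv
        letI := D.algebra
        ∀ τ : v.adicCompletion F →ₐ[ℚ_[p]] PadicAlgCl p,
          χ.labelledHodgeTateWeightsAt v D.algebra D.𝔅 τ.toRingHom = {-m} := by
  intro m χ hχ v hv
  -- the entry of `χ|_{Γ_{F_v}}` is `ε_{F_v}^m`
  have hχv : ∀ σ, ((χ.toLocal v) σ).val 0 0 = algebraMap ℚ_[p] (PadicAlgCl p)
      ((((GaloisRep.cyclotomicCharacter (v.adicCompletion F) p σ : ℤ_[p]ˣ) : ℤ_[p]) :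
        ℚ_[p]) ^ m) := by
    intro σ
    rw [FramedGaloisRep.toLocal_apply, hχ,
      cyclotomicCharacter_absGaloisRestrict F (v.adicCompletion F) p σ]
  exact hloc v hv m (χ.toLocal v) hχv


/-- **`LiftB2CrysSplitP` = local cyclotomic pin + the `RD`-dependent remainder.**  If the local
clause (F8) holds for the pinned datum of every completion `F_v`, `v ∣ p`, of every number field
(hypothesis `hloc`, quantified over all `F`, `p`), and the REMAINDER of the item holds — the
same statement with the first conjunct deleted: for `F` totally real and `p ≥ 7` splitting
completely there are reciprocity data `RD` carrying the (A)₂ pin and the split-prime lifting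
slice (hypothesis `hrest`, verbatim the route text minus the pin) — then `LiftB2CrysSplitP`.
This records the exact restated signature should the planner separate the pin (which no longer
constrains a prover choice since `RD.pst` was pinned, D-0018 L2) from the slice. [folklore] -/
theorem LiftB2CrysSplitP_of_localPin_of_rest
    (hloc : ∀ (F : Type) [Field F] [NumberField F] (p : ℕ) [Fact p.Prime]
      (v : HeightOneSpectrum (𝓞 F)) (hv : ((p : ℕ) : 𝓞 F) ∈ v.asIdeal) (m : ℤ)
      (χv : FramedGaloisRep (v.adicCompletion F) (PadicAlgCl p) 1),
      (∀ σ, (χv σ).val 0 0 = algebraMap ℚ_[p] (PadicAlgCl p)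
        ((((GaloisRep.cyclotomicCharacter (v.adicCompletion F) p σ : ℤ_[p]ˣ) : ℤ_[p]) :
          ℚ_[p]) ^ m)) →
      let D := Literature.NumberTheory.PAdicHodge.fontainePstAdicCompletion v p hv
      letI := D.algebra
      ∀ τ : v.adicCompletion F →ₐ[ℚ_[p]] PadicAlgCl p,
        D.𝔅.labelledHodgeTateWeights χv.toGaloisRep τ.toRingHom = {-m})
    (hrest : ∀ (F : Type) [Field F] [NumberField F] [NumberField.IsTotallyReal F] (p : ℕ) [Fact
      p.Prime], 7 ≤ p → (∀ v : IsDedekindDomain.HeightOneSpectrum (NumberField.RingOfIntegers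
      F), ((p : ℕ) : NumberField.RingOfIntegers F) ∈ v.asIdeal → v.residueCard = p ∧ ¬ v.asIdeal
      ^ 2 ∣ Ideal.span {((p : ℕ) : NumberField.RingOfIntegers F)}) → ∃ RD : ReciprocityData F, ∀
      hcpt : Literature.NumberTheory.Automorphic.isCompact_glFiniteIntegralLevel 2 F, (∀ π :
      Literature.NumberTheory.Automorphic.CuspidalAutomorphicRepData 2 F hcpt, π.1.IsLAlgebraic
      → (∃ T : Literature.NumberTheory.Automorphic.InfinityType F 2, π.1.HasInfinityType T ∧
      T.IsRegular) → ∀ (ℓ : ℕ) [Fact ℓ.Prime] (ι : PadicAlgCl ℓ ≃+* ℂ), ∃ ρ :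
      Literature.NumberTheory.GaloisRepresentations.FramedGaloisRep F (PadicAlgCl ℓ) 2,
      ρ.toGaloisRep.IsIrreducible ∧ IsGeometricFramed RD ρ ∧ Corresponds RD ι π.1 ρ) ∧ (∀ (ι :
      PadicAlgCl p ≃+* ℂ) (ρ : Literature.NumberTheory.GaloisRepresentations.FramedGaloisRep F
      (PadicAlgCl p) 2), ρ.toGaloisRep.IsIrreducible → IsGeometricFramed RD ρ → ρ.IsOdd → (∀ (v
      : IsDedekindDomain.HeightOneSpectrum (NumberField.RingOfIntegers F)) (hv : ((p : ℕ) :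
      NumberField.RingOfIntegers F) ∈ v.asIdeal), let D := RD.pst p v hv; D.IsCrystallineFramed
      (ρ.toLocal v) ∧ (letI := D.algebra; ∀ τ : v.adicCompletion F →ₐ[ℚ_[p]] PadicAlgCl p,
      let M := ρ.labelledHodgeTateWeightsAt v D.algebra D.𝔅 τ.toRingHom;
      M.Nodup ∧ Multiset.card M = 2)) → (∀ v : IsDedekindDomain.HeightOneSpectrum
      (NumberField.RingOfIntegers F), ((p : ℕ) : NumberField.RingOfIntegers F) ∈ v.asIdeal → ∀
      χ₁ χ₂ : Field.absoluteGaloisGroup (v.adicCompletion F) →* (PadicAlgCl p)ˣ, IsOpen (χ₁.ker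
      : Set (Field.absoluteGaloisGroup (v.adicCompletion F))) → IsOpen (χ₂.ker : Set
      (Field.absoluteGaloisGroup (v.adicCompletion F))) → (∀ σ, ‖(ρ.toLocal v σ).val.trace -
      ((χ₁ σ : PadicAlgCl p) + (χ₂ σ : PadicAlgCl p))‖ < 1) → (∃ σ, 1 ≤ ‖(χ₁ σ : PadicAlgCl p) *
      (χ₂ σ : PadicAlgCl p)⁻¹ - 1‖) ∧ (∃ σ, 1 ≤ ‖(χ₁ σ : PadicAlgCl p) * (χ₂ σ : PadicAlgCl p)⁻¹
      - algebraMap ℚ_[p] (PadicAlgCl p)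
      (((Literature.NumberTheory.GaloisRepresentations.GaloisRep.cyclotomicCharacter
      (v.adicCompletion F) p σ : ℤ_[p]ˣ) : ℤ_[p]) : ℚ_[p])‖)) → (¬ ∃ χ₁ χ₂ :
      Field.absoluteGaloisGroup (CyclotomicField p F) →* (PadicAlgCl p)ˣ, IsOpen (χ₁.ker : Set
      (Field.absoluteGaloisGroup (CyclotomicField p F))) ∧ IsOpen (χ₂.ker : Set
      (Field.absoluteGaloisGroup (CyclotomicField p F))) ∧ ∀ σ, ‖(ρ.restrictField
      (CyclotomicField p F) σ).val.trace - ((χ₁ σ : PadicAlgCl p) + (χ₂ σ : PadicAlgCl p))‖ < 1)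
      → (∃ (π₀ : Literature.NumberTheory.Automorphic.CuspidalAutomorphicRepData 2 F hcpt) (ρ₀ :
      Literature.NumberTheory.GaloisRepresentations.FramedGaloisRep F (PadicAlgCl p) 2),
      π₀.1.IsLAlgebraic ∧ (∃ T : Literature.NumberTheory.Automorphic.InfinityType F 2,
      π₀.1.HasInfinityType T ∧ T.IsRegular) ∧ Corresponds RD ι π₀.1 ρ₀ ∧ ∀ σ, ‖(ρ σ).val.trace -
      (ρ₀ σ).val.trace‖ < 1) → ∃ π :
      Literature.NumberTheory.Automorphic.CuspidalAutomorphicRepData 2 F hcpt, π.1.IsLAlgebraic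
      ∧ Corresponds RD ι π.1 ρ)) :
    LiftB2CrysSplitP := by
  intro F _ _ _ p _ hp hsplit
  obtain ⟨RD, hRD⟩ := hrest F p hp hsplit
  exact ⟨RD, pin_of_localPin F p (fun v hv m χv hχv => hloc F p v hv m χv hχv) RD, hRD⟩

end Summit.Langlands.Langlands.Theorems.LiftB2CrysSplitP
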